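import Mathlib
import Summits.CriticalPhenomena.CardyFormulaZ2.Theorems.CardyMagicRigidityNestingRigiditySoftMachinePatternCount
import Summits.CriticalPhenomena.CardyFormulaZ2.Theorems.CardyMagicRigidityNestingRigidityPrecompactnessRegularAssembly
import Summits.CriticalPhenomena.CardyFormulaZ2.Theorems.CardyMagicRigidityNestingRigidityPrecompactnessLimitSamples
import Summits.CriticalPhenomena.CardyFormulaZ2.Theorems.CardyMagicRigidityNestingRigidityPrecompactnessLocallyFinite
import Summits.CriticalPhenomena.CardyFormulaZ2.Theorems.CardyMagicRigidityNestingRigidityPrecompactnessReduction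
import Summits.CriticalPhenomena.CardyFormulaZ2.Theorems.CardyMagicRigidityNestingRigidityTowerPressureSanity
import HarnessLib

/-!
# Soft machine, brick 14: `TamePrecompact tEns` from the HARD a.s. limit fields alone (tameness, separating, dust)

Crux `Summit.CriticalPhenomena.CardyFormulaZ2.Theses.CardyMagicRigidity.NestingRigidity`
(stmt-CriticalPhenomena-4835), line `positive-cone-weight-doubling`, registered stub `stub_tamePrecompactness :
TamePrecompact zEns ∧ TamePrecompact tEns`.  The END of the soft road for `tEns`: combining THE SOFT MACHINE
(bricks 6–9: hit-measurable sequential `d_CN`-limit presentations, unconditionally), the measurable typed counts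
(bricks 12–13), the a.s. `degreeOne` / `laminar` / local-finiteness of EVERY limit presentation (p129158, p129600)
and the pruning of point loops (p129759), `TamePrecompact tEns` is reduced to three a.s. statements about the
limit samples `X s` of ANY hit-measurable sequential `d_CN`-limit presentation of `tEns`
(`tamePrecompact_tEns_of_ae_tame_separating_dust`, registered anchor):

  (T) every NON-POINT loop of `X s` is `Tame` (single-signed degree one, trace = frontier of the interior, solid,
      at most double points);  (S) two non-point loops with the same winding interior coincide up to reversal;
  (D) every point loop is a `udist`-limit of non-point loops of its type.

The tame-regular presentation is the PRUNED one `s ↦ ⟨fun i ↦ {u ∈ (X s).F i | u.range.Nontrivial}⟩`; pruning keeps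
hit-measurability (`SoftMachine.hit_prune`: non-point loops form an OPEN set of unbased loops).  The `zEns` copy,
given the bond multiple-traversal estimate: `tamePrecompact_zEns_of_traversalBound_of_ae_tame_separating_dust`.
-/

noncomputable section

open MeasureTheory Set Filter Metric TopologicalSpace Function
open scoped Topology ENNReal NNReal unitInterval

namespace Summit.CriticalPhenomena.CardyFormulaZ2.Cruxes.NestingRigidity.PositiveConeWeightDoubling

open Literature.Probability.RandomPlanarGeometry Literature.Probability.Percolation
  Literature.Probability.LatticeModels
open Summit.CriticalPhenomena.CardyFormulaZ2.Cruxes.NestingRigidity.RingCloudTomography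

namespace SoftMachine

/-- Non-point loops (loops with non-trivial trace) form an open set of unbased loops. -/
theorem isOpen_setOf_range_nontrivial : IsOpen {u : UnbasedLoop ℂ | u.range.Nontrivial} := by
  rw [Metric.isOpen_iff]
  rintro u ⟨a, ha, b, hb, hab⟩
  have hd : 0 < dist a b := dist_pos.2 hab
  refine ⟨dist a b / 3, by positivity, fun v hv ↦ ?_⟩
  rw [mem_ball, dist_comm] at hv
  obtain ⟨a', ha', haa'⟩ := UnbasedLoop.exists_mem_range_dist_le u v ha
  obtain ⟨b', hb', hbb'⟩ := UnbasedLoop.exists_mem_range_dist_le u v hb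
  refine ⟨a', ha', b', hb', fun h ↦ ?_⟩
  rw [h] at haa'
  have hud := UnbasedLoop.udist_le_dist u v
  have h1 := dist_triangle a b' b
  rw [dist_comm b' b] at h1
  linarith

/-- **Pruning point loops keeps the hitting events measurable.** -/
theorem hit_prune {T : Type*} [MeasurableSpace T] {X : T → LoopConfig ℂ}
    (hX : ∀ (i : Fin 2) (Q : Set (UnbasedLoop ℂ)), IsClosed Q → MeasurableSet {t | ∃ u ∈ (X t).F i, u ∈ Q}) :
    ∀ (i : Fin 2) (Q : Set (UnbasedLoop ℂ)), IsClosed Q → MeasurableSet {t | ∃ u ∈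
      (⟨fun i ↦ {u ∈ (X t).F i | u.range.Nontrivial}⟩ : LoopConfig ℂ).F i, u ∈ Q} := by
  intro i Q hQ
  have hset : {t | ∃ u ∈ (⟨fun i ↦ {u ∈ (X t).F i | u.range.Nontrivial}⟩ : LoopConfig ℂ).F i, u ∈ Q} =
      {t | ∃ u ∈ (X t).F i, u ∈ {u : UnbasedLoop ℂ | u.range.Nontrivial} ∩ Q} := by
    ext t
    simp only [mem_setOf_eq, mem_inter_iff]
    exact ⟨fun ⟨u, ⟨hu, hn⟩, hQ⟩ ↦ ⟨u, hu, hn, hQ⟩, fun ⟨u, hu, hn, hQ⟩ ↦ ⟨u, ⟨hu, hn⟩, hQ⟩⟩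
  rw [hset]
  exact measurableSet_hit_open_inter_closed hX i isOpen_setOf_range_nontrivial hQ

end SoftMachine

/-- **Registered anchor** (`tamePrecompact_tEns_of_ae_tame_separating_dust`): `TamePrecompact tEns` holds as soon as,
for every mesh sequence `δₖ → 0⁺` and every presentation `X : [0,1] → C` of a sequential `d_CN`-limit of the site-`𝕋`
loop ensembles with measurable hitting events, almost surely (T) every non-point loop of `X s` is `Tame`, (S) two
non-point loops of `X s` with equal winding interiors coincide up to reversal, and (D) every point loop of `X s` is a
`udist`-limit of non-point loops of `X s` of its type.  Everything else — the existence of such limit presentations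
along a subsequence, their measurability, `degreeOne`, `laminar`, local finiteness, the pruning — is a theorem. -/
theorem tamePrecompact_tEns_of_ae_tame_separating_dust :
    (∀ (δs : ℕ → ℝ) (X : unitInterval → LoopConfig ℂ), Tendsto δs atTop (𝓝[>] (0 : ℝ)) →
      (∀ (i : Fin 2) (Q : Set (UnbasedLoop ℂ)), IsClosed Q → MeasurableSet {s | ∃ u ∈ (X s).F i, u ∈ Q}) →
      Tendsto (fun k : ℕ ↦ LoopConfig.cnLawEDist tEns.P (tEns.X (δs k)) volume X) atTop (𝓝 0) →
      (∀ᵐ s : unitInterval, ∀ u ∈ (X s).loops, u.range.Nontrivial → Tame u) ∧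
      (∀ᵐ s : unitInterval, ∀ u ∈ (X s).loops, ∀ v ∈ (X s).loops, u.range.Nontrivial → v.range.Nontrivial →
        {z | u.wind z ≠ 0} = {z | v.wind z ≠ 0} → u = v ∨ u = v.reverse) ∧
      (∀ᵐ s : unitInterval, ∀ (i : Fin 2), ∀ u ∈ (X s).F i, ¬ u.range.Nontrivial → ∀ ε : ℝ, 0 < ε →
        ∃ v ∈ (X s).F i, v.range.Nontrivial ∧ u.udist v ≤ ε)) →
    TamePrecompact tEns := by
  intro hfields
  haveI : IsProbabilityMeasure tEns.P := isProbabilityMeasure_of_mem tEns_mem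
  refine tamePrecompact_tEns_of_tameRegularModification fun δs X hδs hXhit hconv ↦ ?_
  obtain ⟨hT, hS, hD⟩ := hfields δs X hδs hXhit hconv
  have hm : ∀ (k : ℕ) (ε : ℝ),
      MeasurableSet {p : tEns.Ω × unitInterval | LoopConfig.IsClose ε (tEns.X (δs k) p.1) (X p.2)} :=
    fun k ε ↦ softMachine_measurableSet_isClose_latticeEnsembles_all tEns tEns_mem (δs k) ε unitInterval X hXhit
  refine ⟨fun s ↦ ⟨fun i ↦ {u ∈ (X s).F i | u.range.Nontrivial}⟩, SoftMachine.hit_prune hXhit, ?_, ?_⟩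
  · filter_upwards [ae_degreeOne_laminar_of_tendsto_cnLawEDist tEns tEns_mem δs volume X hδs hm hconv,
      ae_isLocallyFinite_of_tendsto_cnLawEDist tEns tEns_mem δs volume X hδs hm hconv, hT, hS] with s hdl hlf ht hs'
    refine ⟨Precompact.regular_prune hlf hdl.1 hdl.2 (fun u hu hnt ↦ (ht u hu hnt).boundary) hs', fun u hu ↦ ?_⟩
    exact ht u (Precompact.loops_prune_subset (X s) hu) (Precompact.nontrivial_of_mem_loops_prune hu)
  · refine Precompact.tendsto_cnLawEDist_of_ae_cnEDist_eq_zero tEns.P (fun k ↦ tEns.X (δs k)) volume ?_ hconv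
    filter_upwards [hD] with s hs
    exact Precompact.cnEDist_prune_eq_zero hs

/-- The same for `zEns`, given the bond multiple-traversal estimate (H1) (bricks 11, 13). -/
theorem tamePrecompact_zEns_of_traversalBound_of_ae_tame_separating_dust
    (hH1 : ∃ (k : ℕ) (K lam : ℝ), 0 ≤ K ∧ 2 < lam ∧ ∀ (M : Set (Sym2 (Site 2))) (δ : ℝ), δ ∈ Set.Ioc (0 : ℝ) 1 →
      ∀ (x : ℂ) (ρ R : ℝ), δ ≤ ρ → ρ < R → R ≤ 1 →
        bondPercolation (zdGraph 2) half {ω | ∃ γ : List MedialVertex, IsInterfaceLoop (ω ∩ M) γ ∧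
          (⟨Literature.Probability.LatticeModels.polyline ((γ ++ γ.take 1).map (medialPoint δ))⟩ : Curve ℂ).HasTraversals
            k x ρ R} ≤ ENNReal.ofReal (K * (ρ / R) ^ lam))
    (hfields : ∀ (δs : ℕ → ℝ) (X : unitInterval → LoopConfig ℂ), Tendsto δs atTop (𝓝[>] (0 : ℝ)) →
      (∀ (i : Fin 2) (Q : Set (UnbasedLoop ℂ)), IsClosed Q → MeasurableSet {s | ∃ u ∈ (X s).F i, u ∈ Q}) →
      Tendsto (fun k : ℕ ↦ LoopConfig.cnLawEDist zEns.P (zEns.X (δs k)) volume X) atTop (𝓝 0) →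
      (∀ᵐ s : unitInterval, ∀ u ∈ (X s).loops, u.range.Nontrivial → Tame u) ∧
      (∀ᵐ s : unitInterval, ∀ u ∈ (X s).loops, ∀ v ∈ (X s).loops, u.range.Nontrivial → v.range.Nontrivial →
        {z | u.wind z ≠ 0} = {z | v.wind z ≠ 0} → u = v ∨ u = v.reverse) ∧
      (∀ᵐ s : unitInterval, ∀ (i : Fin 2), ∀ u ∈ (X s).F i, ¬ u.range.Nontrivial → ∀ ε : ℝ, 0 < ε →
        ∃ v ∈ (X s).F i, v.range.Nontrivial ∧ u.udist v ≤ ε)) :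
    TamePrecompact zEns := by
  haveI : IsProbabilityMeasure zEns.P := isProbabilityMeasure_of_mem zEns_mem
  refine tamePrecompact_zEns_of_traversalBound_of_tameRegularModification hH1 fun δs X hδs hXhit hconv ↦ ?_
  obtain ⟨hT, hS, hD⟩ := hfields δs X hδs hXhit hconv
  have hm : ∀ (k : ℕ) (ε : ℝ),
      MeasurableSet {p : zEns.Ω × unitInterval | LoopConfig.IsClose ε (zEns.X (δs k) p.1) (X p.2)} :=
    fun k ε ↦ softMachine_measurableSet_isClose_latticeEnsembles_all zEns zEns_mem (δs k) ε unitInterval X hXhit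
  refine ⟨fun s ↦ ⟨fun i ↦ {u ∈ (X s).F i | u.range.Nontrivial}⟩, SoftMachine.hit_prune hXhit, ?_, ?_⟩
  · filter_upwards [ae_degreeOne_laminar_of_tendsto_cnLawEDist zEns zEns_mem δs volume X hδs hm hconv,
      ae_isLocallyFinite_of_tendsto_cnLawEDist zEns zEns_mem δs volume X hδs hm hconv, hT, hS] with s hdl hlf ht hs'
    refine ⟨Precompact.regular_prune hlf hdl.1 hdl.2 (fun u hu hnt ↦ (ht u hu hnt).boundary) hs', fun u hu ↦ ?_⟩
    exact ht u (Precompact.loops_prune_subset (X s) hu) (Precompact.nontrivial_of_mem_loops_prune hu)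
  · refine Precompact.tendsto_cnLawEDist_of_ae_cnEDist_eq_zero zEns.P (fun k ↦ zEns.X (δs k)) volume ?_ hconv
    filter_upwards [hD] with s hs
    exact Precompact.cnEDist_prune_eq_zero hs

end Summit.CriticalPhenomena.CardyFormulaZ2.Cruxes.NestingRigidity.PositiveConeWeightDoubling

end
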